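import Literature.Geometry.Kaehler.ComplexTorusComplementaryMultidegrees
import Literature.Geometry.Kaehler.ComplexTorusLefschetzGroupSigmaPi
import Literature.Geometry.Kaehler.ComplexTorusComplementaryExponentsProduct
import Mathlib.Algebra.BigOperators.Fin
import Mathlib.Data.Nat.Choose.Multinomial
import HarnessLib

/-!
# Bertrand's Corollary on complementary multidegrees for a product `∏ₖ (Cₖ, λₖ)` of `n` principally polarised
# tori, Newton's formula `deg_λ(W) = Σ_J c(J) deg_J(W)`, and the auxiliary polarisations `λ_z = Σ zₖ pₖ^*λₖ` of its
# proof (Bertrand 1997, §3 (b))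

Layer `Literature/Geometry/Kaehler`, namespace `Literature.Geometry.Kaehler.ComplexTorus`; lane `lit-hodgefound`
(Track 2 foundations library), Layer A4 (cycle classes and degrees on abelian varieties), prover seat
`lit-hodgefound-p09` (generation 16, self-proposed row g16-#2).  Sequel of `ComplexTorusComplementaryMultidegrees.lean`
(Q1620, this seat's generation 15), which proves Bertrand's Corollary ON FORMS for an arbitrary polarised torus with a
symplectic basis whose pairs are distributed into blocks by an arbitrary map `blk : Fin g → β`
(`IsSymplecticEnum.prod_factorial_mul_torusIntegral_chern_wedge_polFlat_of_principal`), Newton's formula in WORD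
form (`IsSymplecticEnum.wedgePow_eq_sum_blockPow : E^{∧b} = Σ_{c : Fin b → β} θ^{c}`) with the multinomial count
`card_filter_wordMult_eq_mul`, and carries out the motivating instance only for the BINARY product `X₁ × X₂`
(`prodPeriod`, §7 there; its header: "Not here: … `n ≥ 3` factors as an explicit iterated product").  This file
supplies the two printed statements in their printed generality:

* the DEPENDENT finite product `(A, λ) = ∏_{k ∈ κ} (C_k, λ_k)` of the tree (`sigmaPiPeriod Ψ`, `piForm ω` of
  `ComplexTorusPoincareCompleteReducibilityIsogeny.lean`; factors of arbitrary dimensions `g_k`), presented by the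
  concatenation of symplectic bases of the factors (`sigmaEnum`), with blocks = factors (`sigmaFactor`) and
  `θ_k = p_k^*E_k` (`IsSymplecticEnum.blockTwoForm_sigmaPi`), whence the COROLLARY for `n` factors
  (`IsSymplecticEnum.prod_factorial_mul_torusIntegral_chern_wedge_polFlat_sigmaPi`);
* NEWTON'S FORMULA grouped by multidegrees, `E^{∧b} = Σ_J c(J) θ^J` summed over the multiplicity vectors
  `J = (r_i)`, `Σ r_i = b` (Mathlib's `Finset.piAntidiag univ b`), with `c(J) = b!/r₁!⋯r_n!` the multinomial
  coefficient `Nat.multinomial univ J` (`IsSymplecticEnum.wedgePow_eq_sum_piAntidiag_multinomial_smul_blockPow`),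
  and its integrated form `∫_σ E^{∧b} = Σ_J c(J) ∫_σ θ^J` (`deg_λ(W) = Σ_J c(J) deg_J(W)`);
* the ingredients of Bertrand's PROOF of the Corollary (p. 214): the polarisations `λ_z = Σ_k z_k p_k^*λ_k`
  (`piForm fun k ↦ (z k : ℝ) • ω k`), their Gram matrices `diag(z_k G_k) = G · diag(z_k 1)` ("the corresponding isogeny
  … is the 'diagonal' map `t_z = (z₁, …, z_n)`"), `K(λ_z) = A[t_z]` for principal factors and
  `|A[t_z]| = ∏ z_k^{2c_k}`, the weighted Newton formula `deg_{λ_z}(W) = Σ_J c(J) z^J deg_J(W)`, and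
  `B_z = t_z^{-1}(B^⊥)` ("`B^⊥` is the set theoretic image of `B_z` under `t_z`") on the real span.

## Source, verbatim

D. Bertrand, *Duality on tori and multiplicative dependence relations*, J. Austral. Math. Soc. (Series A) **62**
(1997) 198–216 [cite: Bertrand1997DualityTori], held text `paper:doi-10-1017-s1446788700000768`, §3 (b) "Complementary
multidegrees" (pp. 213–215; chunks p0016 L46 – p0018 L12):

> "We here suppose that `A` is the product of `n` polarized abelian varieties `(C₁, λ₁), …, (C_n, λ_n)`, and that
> `λ = p₁^*λ₁ + ⋯ + p_n^*λ_n`, where `p_i` is the projection from `A` to `C_i`. Denote by `c_i` the dimension of `C_i`,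
> so that `a = dim A = c₁ + ⋯ + c_n`, and let `J = {r₁, …, r_n}` be a set of integers such that `0 ≤ r_i ≤ c_i` for
> `i = 1, …, n`. In particular, `b := r₁ + ⋯ + r_n ≤ a`. For any subvariety `W` of `A`, of dimension `b`, we may then
> consider the intersection number `deg_J(W) = (W · p₁^*λ₁^{r₁} ⋯ p_n^*λ_n^{r_n})`. […] we shall assume from now on that
> all the `λ_i`'s, hence `λ` as well, are principal polarizations. The relation between `deg_λ(W)` and the different
> multidegrees of `W` is given by Newton's formula: `deg_λ(W) = Σ_J c(J) deg_J(W)`, where `J` runs through all sets of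
> `n`-tuples `{r₁, …, r_n}` as above, and `c(J)` is the binomial coefficient `b!/r₁!⋯r_n!`. […] For each
> `J = {r₁, …, r_n}`, we denote the 'complementary' set of `J` by `J′ = {r′₁ = c₁ − r₁, …, r′_n = c_n − r_n}`, with
> `r′₁ + ⋯ + r′_n := b′ = a − b`.
> COROLLARY. Let `(A, λ) = ∏_{i=1}^n (C_i, λ_i)` be a principally polarized abelian variety, let `B`, `B^⊥` be a pair
> of orthogonal abelian subvarieties with respect to `λ`, of dimension `b`, `b′ = a − b`, and let `J`, `J′` be
> complementary sets of indices as above. Then, `deg_J(B)/r₁!⋯r_n! = deg_{J′}(B^⊥)/r′₁!⋯r′_n!`.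
> PROOF. To any `n`-tuple of variable positive integers `z = (z₁, …, z_n)`, we associate the polarization
> `λ_z = z₁p₁^*λ₁ + ⋯ + z_n p_n^*λ_n` on `A`. The corresponding isogeny from `A` to its dual `A^∨` (which we identify
> with `A` thanks to the principal polarization `λ`) is the 'diagonal' map `t_z = (z₁, …, z_n)` on `C₁ × ⋯ × C_n`, whose
> kernel `A[t_z]` has order `z₁^{2c₁}⋯z_n^{2c_n}`. Applying Theorem 3 (in the shape above) to the orthogonal complement
> `B_z` of `B` with respect to `λ_z`, together with Newton's formula, we obtain: […] where we have set:
> `z^J = z₁^{r₁}⋯z_n^{r_n}` and likewise for `z^{J′}`. Now, `B^⊥` is the set theoretic image of `B_z` under `t_z` […]"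

## Dictionary and contents (definitions with bodies and theorems; NO named fact, net debt 0)

The factors are indexed by a finite type `κ` (Bertrand's `i = 1, …, n`; `κ = Fin n` in `finSigmaEnum` and
`IsSymplecticEnum.prod_factorial_mul_torusIntegral_chern_wedge_polFlat_finSigma`), the factor
`C_k = F_k/Ψ_k(ℤ^{σ_k})` has a symplectic basis `e_k : Fin g_k ⊕ Fin g_k ≃ σ_k` of type `d^k` for `ω_k`
(`IsSymplecticEnum (Ψ k) (e k) (ω k) (d k)`), `A = ∏ C_k = ComplexTorus (sigmaPiPeriod Ψ)` with
`λ ↔ piForm ω = Σ p_k^*ω_k`, `a = G = Σ_k g_k`; a bijection `ε : Fin G ≃ Σ k, Fin (g k)` numbers the pairs of the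
product basis.

* §1 `sigmaEnum e ε : Fin G ⊕ Fin G ≃ Σ k, σ k` (the concatenated symplectic enumeration; `sigmaEnum_inl/inr`),
  `sigmaFactor ε : Fin G → κ` (the factor of a pair), `sigmaType ε d` (the concatenated type), `sigmaEmb ε k a`
  (the position of the pair `(k, a)`; `filter_sigmaFactor_eq_image`, `sigmaType_sigmaEmb`),
  `card_filter_sigmaFactor : #blk⁻¹(k) = g_k` (`c_k = dim C_k`), and the `Fin n`-indexed numbering
  `finSigmaEnum e = sigmaEnum e finSigmaFinEquiv.symm` (`G = Σ g_i` literally).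
* §2 `piForm_single_single_same/_of_ne` (the product basis vectors `(0, …, λ, …, 0)` pair through one factor),
  **`IsPrincipalPolarization.sigmaPi`** (`det diag(G_k) = ∏ det G_k = 1`, by the tree's `latticeGram_sigmaPi` of
  `ComplexTorusLefschetzGroupSigmaPi.lean` and `det_blockDiagonal'_eq_prod`), and **`IsSymplecticEnum.sigmaPi`**: the
  concatenation of symplectic bases of types `d^k` is a symplectic basis of `(∏ C_k, Σ p_k^*ω_k)` of the concatenated
  type (given the divisibility chain); `IsSymplecticEnum.sigmaPi_of_principal`.
* §3 `coord_sigmaPiPeriod` (`x_{(k,a)} = x^k_a ∘ p_k`), `latMonomial_ilvWord_compContinuousLinearMap_proj`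
  (`p_k^* dx^k_{T-pairs} = dx_{(k,T)-pairs}`), `pairMonomial_compContinuousLinearMap_proj`, and
  **`IsSymplecticEnum.blockTwoForm_sigmaPi : θ_k = p_k^*E_k`** (`ofRealForm ((ω k).compContinuousLinearMap (proj k))`;
  `_of_principal`).
* §4 **the COROLLARY for `(A, λ) = ∏_k (C_k, λ_k)`**:
  `IsSymplecticEnum.prod_factorial_mul_torusIntegral_chern_wedge_polFlat_sigmaPi` —
  `J! · ∫_A ch^{c′} ∧ λ♭(σ) = J′! · ∫_σ ch^{c}` for principal factors, words `c`, `c′` in the factors with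
  `r_k + r′_k = g_k`, every `σ ∈ H_{2b}(A, ℤ)`; the same with the Chern forms written as pull-backs
  `c₁(p_k^*L_k) = −p_k^*E_k` (`…_pullback_wedge_polFlat_sigmaPi`, no numbering in the statement), and the
  `Fin n`-numbered form `…_finSigma`.
* §5 **NEWTON'S FORMULA grouped by multidegrees**, `IsSymplecticEnum.wedgePow_eq_sum_piAntidiag_multinomial_smul_blockPow`:
  `E^{∧b} = Σ_{J ∈ piAntidiag univ b} (Nat.multinomial univ J) • θ^{w(J)}` for any choice `w(J)` of words of
  multiplicities `J` (they exist: `exists_wordMult_eq`, `exists_forall_wordMult_eq`; the class sum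
  `Σ_{J(c′) = J(c)} θ^{c′} = c(J) • θ^{c}` is `sum_filter_wordMult_blockPow`, the count
  `#{c′ | J(c′) = J} = b!/∏ r_i! = Nat.multinomial univ J` is `card_filter_wordMult_eq_multinomial`), its Chern form
  `(−E)^{∧b} = Σ_J c(J) • ∧_j (−θ_{w(J) j})` (`…_smul_chern`) and its integrated form
  `IsSymplecticEnum.cycleIntegral_wedgePow_eq_sum_piAntidiag_multinomial` (`∫_σ E^{∧b} = Σ_J c(J) ∫_σ θ^{J}`:
  "`deg_λ(W) = Σ_J c(J) deg_J(W)`" for `σ = [W]`).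
* §6 **`λ_z = Σ z_k p_k^*λ_k` and `t_z`**: `IsRiemannForm.piForm_natCast_smul`, `latticeGram_piForm_smul` (`diag(z_k G_k)`),
  `latticeGram_piForm_smul_eq_mul` (`= G · diag(z_k 1)`: "the corresponding isogeny is the diagonal map `t_z`"),
  `map_sigmaBlockMatrix_smul_eq_latticeGram` (integer Gram), `natCard_kerPhiH_sigmaBlockMatrix_smul`
  (`|K(λ_z)| = ∏ z_k^{rk Λ_k} |det G_k|`), `IsPrincipalPolarization.natCard_kerPhiH_sigmaBlockMatrix_smul`,
  `isIsogeny_sigmaBlockMatrix_smul_one` (`t_z` is an isogeny), `natCard_ker_sigmaBlockMatrix_smul_one(_of_equiv)`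
  (**`|A[t_z]| = ∏ z_k^{2c_k}`**)
  and **`kerPhiH_sigmaBlockMatrix_smul_eq_ker : K(λ_z) = A[t_z]`** for unimodular `G_k`.
* §7 **`E_{λ_z} = Σ z_k θ_k`** (`IsSymplecticEnum.ofRealForm_piForm_smul`) and the WEIGHTED Newton formula:
  `wedgePow_sum_smul_blockTwoForm` (word form `(Σ z_i θ_i)^{∧b} = Σ_c (∏_j z_{c j}) θ^c`),
  `prod_apply_word_eq_prod_pow_wordMult` (`∏_j z_{c j} = z^{J(c)}`), `wedgePow_sum_smul_blockTwoForm_eq_sum_piAntidiag`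
  (`(Σ z_i θ_i)^{∧b} = Σ_J c(J) z^J θ^{J}`), `cycleIntegral_wedgePow_sum_smul_blockTwoForm` and
  **`IsSymplecticEnum.cycleIntegral_wedgePow_piForm_smul`** ("`deg_{λ_z}(W) = Σ_J c(J) z^J deg_J(W)`" on cycles of `∏ C_k`).
* §8 **`B_z = t_z^{-1}(B^⊥)`** on the real span: `sigmaPiPeriod_map_sigmaBlockMatrix_smul_one_mulVec`
  (`Π(diag(z)x)_k = z_k Π(x)_k`), `piForm_smul_apply_eq` (`λ_z(n, m) = λ(n, diag(z) m)`),
  `mem_orthSubspace_piForm_smul_iff` / `orthSubspace_piForm_smul_eq_comap` (`V^{⊥_z} = diag(z)^{-1} V^⊥`) and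
  `map_orthSubspace_piForm_smul` (**`diag(z) · V^{⊥_z} = V^⊥`**: "`B^⊥` is the set theoretic image of `B_z` under `t_z`").

Not here: the remaining steps of the printed proof — the pull-back `(t_z)^*(p_i^*λ_i) = z_i² p_i^*λ_i`, the cycle
identity `(t_z)_*B_z = |B ∩ A[t_z]| · B^⊥` and the projection formula — which need push-forwards of cycles under
isogenies; the Corollary itself is obtained in §4 directly from the tree's form-level duality (Q1620), not by this route.

## References

* [Bertrand1997DualityTori] D. Bertrand, *Duality on tori and multiplicative dependence relations*, J. Austral. Math.
  Soc. Ser. A 62 (1997), §3 (b) pp. 213–215 (Newton's formula, the Corollary).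
* [Lange2023AbelianVarietiesComplex] H. Lange, *Abelian Varieties over the Complex Numbers* (2023), §2.4.4 Cor. 2.4.24,
  Thm. 2.4.25 (products and their polarisations), §2.5.3 (symplectic bases), §1.7.2 Lemma 1.7.4 (`c₁(L) = −E`).
* [Bona2011] M. Bóna, *A Walk Through Combinatorics* (3rd ed., 2011), §3.1 Thm. 3.5 (`n!/(a₁!⋯a_k!)` orderings of a
  multiset) — the multinomial count, through the tree's `card_filter_wordMult_eq_mul`.
-/

noncomputable section

open scoped Matrix
open Module Function Complex Finset
open Literature.LinearAlgebra.Alternating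

universe uF

namespace Literature.Geometry.Kaehler

namespace ComplexTorus

/-! ## §1 The concatenated symplectic enumeration of `∏_k C_k` and its blocks -/

section SigmaEnum

variable {κ : Type*} {σ : κ → Type*} {g : κ → ℕ} (e : ∀ k, Fin (g k) ⊕ Fin (g k) ≃ σ k) {G : ℕ}
  (ε : Fin G ≃ Σ k, Fin (g k))

/-- **The concatenated enumeration of the lattice basis of `∏_k C_k`**: the `ν`-th pair `(λ_ν, μ_ν)` of the product
basis is the pair `(λ^k_a, μ^k_a)` of the factor `k` when `ε ν = (k, a)` — for `e_k` symplectic bases of the factors this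
is a product symplectic basis (`IsSymplecticEnum.sigmaPi`).
[cite: Bertrand1997DualityTori, §3 (b) (p. 213: "`A` is the product of `n` polarized abelian varieties `(C₁, λ₁), …, (C_n, λ_n)`")]
[cite: Lange2023AbelianVarietiesComplex, §2.4.4 Thm. 2.4.25] -/
def sigmaEnum : Fin G ⊕ Fin G ≃ Σ k, σ k :=
  (Equiv.sumCongr ε ε).trans
    ((Equiv.sigmaSumDistrib (fun k ↦ Fin (g k)) (fun k ↦ Fin (g k))).symm.trans (Equiv.sigmaCongrRight e))

/-- `λ_ν = λ^k_a` for `ε ν = (k, a)`. [cite: Lange2023AbelianVarietiesComplex, §2.4.4 Thm. 2.4.25] -/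
@[simp] theorem sigmaEnum_inl (ν : Fin G) : sigmaEnum e ε (Sum.inl ν) = ⟨(ε ν).1, e (ε ν).1 (Sum.inl (ε ν).2)⟩ := rfl

/-- `μ_ν = μ^k_a` for `ε ν = (k, a)`. [cite: Lange2023AbelianVarietiesComplex, §2.4.4 Thm. 2.4.25] -/
@[simp] theorem sigmaEnum_inr (ν : Fin G) : sigmaEnum e ε (Sum.inr ν) = ⟨(ε ν).1, e (ε ν).1 (Sum.inr (ε ν).2)⟩ := rfl

/-- **The factor of a pair: `blk ν = k` for `ε ν = (k, a)`** (block `k` = the pairs coming from `C_k`).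
[cite: Bertrand1997DualityTori, §3 (b) (p. 213)] -/
def sigmaFactor : Fin G → κ := fun ν ↦ (ε ν).1

/-- Unfolding of `sigmaFactor`. [cite: Bertrand1997DualityTori, §3 (b) (p. 213)] -/
@[simp] theorem sigmaFactor_apply (ν : Fin G) : sigmaFactor ε ν = (ε ν).1 := rfl

/-- **The concatenated type**: `d_ν = d^k_a` for `ε ν = (k, a)`. [cite: Lange2023AbelianVarietiesComplex, §1.5.1 and Cor. 2.4.24] -/
def sigmaType (d : ∀ k, Fin (g k) → ℕ) : Fin G → ℕ := fun ν ↦ d (ε ν).1 (ε ν).2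

/-- Unfolding of `sigmaType`. [cite: Lange2023AbelianVarietiesComplex, §1.5.1] -/
@[simp] theorem sigmaType_apply (d : ∀ k, Fin (g k) → ℕ) (ν : Fin G) : sigmaType ε d ν = d (ε ν).1 (ε ν).2 := rfl

/-- The principal type concatenates to the principal type. [cite: Bertrand1997DualityTori, §3 (b) Corollary (p. 214)] -/
theorem sigmaType_one : sigmaType ε (fun _ _ ↦ 1) = fun _ ↦ 1 := rfl

/-- **The position `sigmaEmb ε k a` of the pair `(k, a)` in the product basis** (`ε⁻¹ (k, a)`).
[cite: Lange2023AbelianVarietiesComplex, §2.4.4 Thm. 2.4.25] -/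
def sigmaEmb (k : κ) (a : Fin (g k)) : Fin G := ε.symm ⟨k, a⟩

/-- `ε (sigmaEmb ε k a) = (k, a)`. [cite: Lange2023AbelianVarietiesComplex, §2.4.4 Thm. 2.4.25] -/
@[simp] theorem apply_sigmaEmb (k : κ) (a : Fin (g k)) : ε (sigmaEmb ε k a) = ⟨k, a⟩ := Equiv.apply_symm_apply ε _

/-- `sigmaEmb ε k` is injective. [cite: Lange2023AbelianVarietiesComplex, §2.4.4 Thm. 2.4.25] -/
theorem sigmaEmb_injective (k : κ) : Injective (sigmaEmb ε k) := fun a b h ↦ by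
  have h' := congrArg ε h
  rw [apply_sigmaEmb, apply_sigmaEmb] at h'
  exact eq_of_heq (Sigma.mk.inj h').2

/-- `blk (sigmaEmb ε k a) = k`. [cite: Bertrand1997DualityTori, §3 (b) (p. 213)] -/
@[simp] theorem sigmaFactor_sigmaEmb (k : κ) (a : Fin (g k)) : sigmaFactor ε (sigmaEmb ε k a) = k := by
  rw [sigmaFactor_apply, apply_sigmaEmb]

/-- `d_{sigmaEmb k a} = d^k_a`. [cite: Lange2023AbelianVarietiesComplex, §1.5.1 and Cor. 2.4.24] -/
@[simp] theorem sigmaType_sigmaEmb (d : ∀ k, Fin (g k) → ℕ) (k : κ) (a : Fin (g k)) :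
    sigmaType ε d (sigmaEmb ε k a) = d k a := by
  show d (ε (sigmaEmb ε k a)).1 (ε (sigmaEmb ε k a)).2 = d k a
  rw [apply_sigmaEmb]

/-- `λ_{sigmaEmb k a} = λ^k_a`. [cite: Lange2023AbelianVarietiesComplex, §2.4.4 Thm. 2.4.25] -/
@[simp] theorem sigmaEnum_inl_sigmaEmb (k : κ) (a : Fin (g k)) :
    sigmaEnum e ε (Sum.inl (sigmaEmb ε k a)) = ⟨k, e k (Sum.inl a)⟩ := by
  rw [sigmaEnum_inl, apply_sigmaEmb]

/-- `μ_{sigmaEmb k a} = μ^k_a`. [cite: Lange2023AbelianVarietiesComplex, §2.4.4 Thm. 2.4.25] -/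
@[simp] theorem sigmaEnum_inr_sigmaEmb (k : κ) (a : Fin (g k)) :
    sigmaEnum e ε (Sum.inr (sigmaEmb ε k a)) = ⟨k, e k (Sum.inr a)⟩ := by
  rw [sigmaEnum_inr, apply_sigmaEmb]

/-- **The pairs of block `k` are exactly the `sigmaEmb ε k a`, `a < g_k`.** [cite: Bertrand1997DualityTori, §3 (b) (p. 213)] -/
theorem filter_sigmaFactor_eq_image [DecidableEq κ] (k : κ) :
    (univ.filter fun ν ↦ sigmaFactor ε ν = k) = univ.image (sigmaEmb ε k) := by
  ext ν
  simp only [Finset.mem_filter, Finset.mem_univ, true_and, Finset.mem_image]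
  constructor
  · intro hν
    rw [sigmaFactor_apply] at hν
    rcases hε : ε ν with ⟨l, b⟩
    rw [hε] at hν
    subst hν
    exact ⟨b, ε.injective (by rw [apply_sigmaEmb, hε])⟩
  · rintro ⟨a, rfl⟩
    exact sigmaFactor_sigmaEmb ε k a

/-- **`#blk⁻¹(k) = g_k`: the dimension of the factor `C_k` is the size of its block** (Bertrand's `c_i = dim C_i`).
[cite: Bertrand1997DualityTori, §3 (b) (p. 213: "Denote by `c_i` the dimension of `C_i`")] -/
theorem card_filter_sigmaFactor [DecidableEq κ] (k : κ) :
    (univ.filter fun ν ↦ sigmaFactor ε ν = k).card = g k := by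
  rw [filter_sigmaFactor_eq_image, Finset.card_image_of_injective _ (sigmaEmb_injective ε k), Finset.card_univ,
    Fintype.card_fin]

end SigmaEnum

/-! ### The `Fin n`-numbering: `G = g₀ + ⋯ + g_{n-1}`, pairs numbered factor by factor -/

section FinSigma

variable {n : ℕ} {σ : Fin n → Type*} {g : Fin n → ℕ} (e : ∀ k, Fin (g k) ⊕ Fin (g k) ≃ σ k)

/-- **The product symplectic enumeration of `∏_{i < n} C_i` numbered factor by factor** (`λ¹₁, …, λ¹_{c₁}, λ²₁, …`):
`sigmaEnum` for Mathlib's `finSigmaFinEquiv : (Σ i, Fin (g i)) ≃ Fin (Σ i, g i)`.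
[cite: Bertrand1997DualityTori, §3 (b) (p. 213: "`(C₁, λ₁), …, (C_n, λ_n)` … `a = dim A = c₁ + ⋯ + c_n`")] -/
def finSigmaEnum : Fin (∑ i, g i) ⊕ Fin (∑ i, g i) ≃ Σ k, σ k := sigmaEnum e finSigmaFinEquiv.symm

/-- Unfolding of `finSigmaEnum`. [cite: Bertrand1997DualityTori, §3 (b) (p. 213)] -/
theorem finSigmaEnum_eq : finSigmaEnum e = sigmaEnum e finSigmaFinEquiv.symm := rfl

end FinSigma

/-! ## §2 The product lattice basis of `∏_k C_k`: Gram matrix, principal polarisations, symplectic bases -/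

section SigmaPi

variable {κ : Type*} [Fintype κ] [DecidableEq κ] {σ : κ → Type*} [∀ k, Fintype (σ k)] [∀ k, DecidableEq (σ k)]
  {F : κ → Type*} [∀ k, NormedAddCommGroup (F k)] [∀ k, NormedSpace ℂ (F k)]
  (Ψ : ∀ k, (σ k → ℝ) ≃L[ℝ] F k) (ω : ∀ k, F k [⋀^Fin 2]→L[ℝ] ℝ)

/-- `ω(0, y) = 0`. [folklore] -/
private theorem twoForm_zero_left'' {V : Type*} [NormedAddCommGroup V] [NormedSpace ℂ V]
    (θ : V [⋀^Fin 2]→L[ℝ] ℝ) (y : V) : θ ![0, y] = 0 := by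
  rw [← zero_smul ℝ (0 : V), twoForm_smul_left, zero_mul]

/-- `ω(x, 0) = 0`. [folklore] -/
private theorem twoForm_zero_right'' {V : Type*} [NormedAddCommGroup V] [NormedSpace ℂ V]
    (θ : V [⋀^Fin 2]→L[ℝ] ℝ) (x : V) : θ ![x, 0] = 0 := by
  rw [← zero_smul ℝ (0 : V), twoForm_smul_right, zero_mul]

/-- `Π(e_{(k,i)}) = (0, …, Ψ_k(e_i), …, 0)`: a lattice basis vector of the product is a lattice basis vector of one
factor, put in that factor (the case `c = 1` of p16's `sigmaPiPeriod_single` of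
`ComplexTorusPolarizationFiniteProductInequality.lean`, not imported here to keep the theta machinery out of this
file's imports — as in `ComplexTorusLefschetzGroupSigmaPi.lean`). [cite: Lange2023AbelianVarietiesComplex, §2.4.4 Thm. 2.4.25 (the lattice `⊕_k Λ_k`), p. 123] -/
private theorem sigmaPiPeriod_single_one (k : κ) (i : σ k) :
    sigmaPiPeriod Ψ (Pi.single (⟨k, i⟩ : Σ l, σ l) (1 : ℝ)) = Pi.single k (Ψ k (Pi.single i 1)) := by
  funext l
  rw [sigmaPiPeriod_apply]
  by_cases hl : l = k
  · subst hl
    rw [Pi.single_eq_same]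
    congr 1
    funext j
    by_cases hj : j = i
    · subst hj
      rw [Pi.single_eq_same, Pi.single_eq_same]
    · rw [Pi.single_eq_of_ne hj, Pi.single_eq_of_ne (fun h ↦ hj (eq_of_heq (Sigma.mk.inj h).2))]
  · rw [Pi.single_eq_of_ne hl]
    have h0 : (fun j ↦ (Pi.single (⟨k, i⟩ : Σ l, σ l) (1 : ℝ) : (Σ l, σ l) → ℝ) ⟨l, j⟩) = 0 :=
      funext fun j ↦ by rw [Pi.zero_apply]; exact Pi.single_eq_of_ne (fun h ↦ hl (congrArg Sigma.fst h)) _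
    rw [h0, map_zero]

/-- **Vectors of one factor pair through that factor: `(⊞_l ω_l)((0,…,u,…,0), (0,…,v,…,0)) = ω_k(u, v)`.**
[cite: Lange2023AbelianVarietiesComplex, §2.4.4 Cor. 2.4.24 (`H₁ ⊕ H₂`), p. 123] -/
theorem piForm_single_single_same (k : κ) (u v : F k) :
    piForm ω ![Pi.single k u, Pi.single k v] = ω k ![u, v] := by
  rw [piForm_apply, Finset.sum_eq_single k]
  · rw [Pi.single_eq_same, Pi.single_eq_same]
  · intro l _ hl
    rw [Pi.single_eq_of_ne hl, twoForm_zero_left'']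
  · exact fun h ↦ absurd (Finset.mem_univ k) h

/-- **Vectors of different factors are orthogonal: `(⊞_l ω_l)((…,u,…), (…,v,…)) = 0` for `u ∈ F_k`, `v ∈ F_l`, `k ≠ l`.**
[cite: Lange2023AbelianVarietiesComplex, §2.4.4 Cor. 2.4.24 (`H₁ ⊕ H₂`), p. 123] -/
theorem piForm_single_single_of_ne {k l : κ} (hkl : k ≠ l) (u : F k) (v : F l) :
    piForm ω ![Pi.single k u, Pi.single l v] = 0 := by
  rw [piForm_apply]
  refine Finset.sum_eq_zero fun m _ ↦ ?_
  by_cases hm : m = k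
  · subst hm
    rw [Pi.single_eq_of_ne hkl, twoForm_zero_right'']
  · rw [Pi.single_eq_of_ne hm, twoForm_zero_left'']

/-- Two product basis vectors of the same factor pair through that factor.
[cite: Lange2023AbelianVarietiesComplex, §2.4.4 Cor. 2.4.24 and Thm. 2.4.25, p. 123] -/
theorem piForm_sigmaPiPeriod_single_same (k : κ) (a b : σ k) :
    piForm ω ![sigmaPiPeriod Ψ (Pi.single ⟨k, a⟩ 1), sigmaPiPeriod Ψ (Pi.single ⟨k, b⟩ 1)] =
      ω k ![Ψ k (Pi.single a 1), Ψ k (Pi.single b 1)] := by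
  rw [sigmaPiPeriod_single_one, sigmaPiPeriod_single_one, piForm_single_single_same]

/-- Two product basis vectors of different factors are orthogonal.
[cite: Lange2023AbelianVarietiesComplex, §2.4.4 Cor. 2.4.24 and Thm. 2.4.25, p. 123] -/
theorem piForm_sigmaPiPeriod_single_of_ne {k l : κ} (hkl : k ≠ l) (a : σ k) (b : σ l) :
    piForm ω ![sigmaPiPeriod Ψ (Pi.single ⟨k, a⟩ 1), sigmaPiPeriod Ψ (Pi.single ⟨l, b⟩ 1)] = 0 := by
  rw [sigmaPiPeriod_single_one, sigmaPiPeriod_single_one, piForm_single_single_of_ne ω hkl]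

/-- **A finite product of principally polarised tori is principally polarised** (`det diag(G_k) = ∏ det G_k = 1`;
"we shall assume from now on that all the `λ_i`'s, hence `λ` as well, are principal polarizations").
[cite: Bertrand1997DualityTori, §3 (b) (p. 214)] [cite: Lange2023AbelianVarietiesComplex, §2.4.4 Cor. 2.4.24] -/
theorem IsPrincipalPolarization.sigmaPi {Ψ : ∀ k, (σ k → ℝ) ≃L[ℝ] F k} {ω : ∀ k, F k [⋀^Fin 2]→L[ℝ] ℝ}
    (h : ∀ k, IsPrincipalPolarization (Ψ k) (ω k)) : IsPrincipalPolarization (sigmaPiPeriod Ψ) (piForm ω) := by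
  refine ⟨IsRiemannForm.sigmaPi fun k ↦ (h k).isRiemannForm, ?_⟩
  rw [latticeGram_sigmaPi, det_blockDiagonal'_eq_prod]
  exact Finset.prod_eq_one fun k _ ↦ (h k).det_latticeGram

variable {g : κ → ℕ} (e : ∀ k, Fin (g k) ⊕ Fin (g k) ≃ σ k) {G : ℕ} (ε : Fin G ≃ Σ k, Fin (g k))
  {d : ∀ k, Fin (g k) → ℕ}

/-- **The concatenation of symplectic bases of the factors `(C_k, ω_k)` (types `d^k`) is a symplectic basis of
`(∏_k C_k, ⊞_k ω_k)` of the concatenated type** — whenever the concatenated type is again a divisibility chain (e.g.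
for principal polarisations, `IsSymplecticEnum.sigmaPi_of_principal`): different factors are orthogonal, equal factors
pair as in the factor. [cite: Lange2023AbelianVarietiesComplex, §2.4.4 Cor. 2.4.24 (`p₁^*L₁ ⊗ p₂^*L₂` has hermitian form `H₁ ⊕ H₂`) and Thm. 2.4.25] [cite: Bertrand1997DualityTori, §3 (b) (p. 213)] -/
theorem IsSymplecticEnum.sigmaPi (h : ∀ k, IsSymplecticEnum (Ψ k) (e k) (ω k) (d k))
    (hd : ∀ i j, i ≤ j → sigmaType ε d i ∣ sigmaType ε d j) :
    IsSymplecticEnum (sigmaPiPeriod Ψ) (sigmaEnum e ε) (piForm ω) (sigmaType ε d) := by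
  refine ⟨hd, fun i j ↦ ?_, fun i j ↦ ?_, fun i j ↦ ?_⟩
  · rw [sigmaEnum_inl, sigmaEnum_inl]
    rcases ε i with ⟨k, a⟩
    rcases ε j with ⟨l, b⟩
    dsimp only
    by_cases hkl : k = l
    · subst hkl
      rw [piForm_sigmaPiPeriod_single_same]
      exact (h k).left_left a b
    · exact piForm_sigmaPiPeriod_single_of_ne Ψ ω hkl _ _
  · rw [sigmaEnum_inr, sigmaEnum_inr]
    rcases ε i with ⟨k, a⟩
    rcases ε j with ⟨l, b⟩
    dsimp only
    by_cases hkl : k = l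
    · subst hkl
      rw [piForm_sigmaPiPeriod_single_same]
      exact (h k).right_right a b
    · exact piForm_sigmaPiPeriod_single_of_ne Ψ ω hkl _ _
  · by_cases hij : i = j
    · subst hij
      rw [if_pos rfl, sigmaType_apply, sigmaEnum_inl, sigmaEnum_inr]
      rcases ε i with ⟨k, a⟩
      dsimp only
      rw [piForm_sigmaPiPeriod_single_same, (h k).left_right, if_pos rfl]
    · rw [if_neg hij, sigmaEnum_inl, sigmaEnum_inr]
      have hne : ε i ≠ ε j := fun h' ↦ hij (ε.injective h')
      revert hne
      rcases ε i with ⟨k, a⟩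
      rcases ε j with ⟨l, b⟩
      intro hne
      dsimp only
      by_cases hkl : k = l
      · subst hkl
        rw [piForm_sigmaPiPeriod_single_same, (h k).left_right, if_neg (fun hab ↦ hne (by rw [hab]))]
      · exact piForm_sigmaPiPeriod_single_of_ne Ψ ω hkl _ _

/-- **Principal factors**: principal symplectic bases of the `(C_k, λ_k)` concatenate to a principal symplectic basis
of `(A, λ) = ∏_k (C_k, λ_k)` (type `(1, …, 1)`, as in Bertrand's Corollary).
[cite: Bertrand1997DualityTori, §3 (b) Corollary (p. 214: "`(A, λ) = ∏_{i=1}^n (C_i, λ_i)` … principally polarized")] [cite: Lange2023AbelianVarietiesComplex, §2.4.4 Cor. 2.4.24] -/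
theorem IsSymplecticEnum.sigmaPi_of_principal (h : ∀ k, IsSymplecticEnum (Ψ k) (e k) (ω k) fun _ ↦ 1) :
    IsSymplecticEnum (sigmaPiPeriod Ψ) (sigmaEnum e ε) (piForm ω) fun _ ↦ 1 :=
  IsSymplecticEnum.sigmaPi Ψ ω e ε (d := fun _ _ ↦ 1) h fun _ _ _ ↦ one_dvd _

/-! ## §3 The block forms of the product basis are the pulled-back polarisation forms: `θ_k = p_k^*E_k` -/

omit [DecidableEq κ] [∀ k, DecidableEq (σ k)] in
/-- **The coordinates of the product: `x_{(k,a)} = x^k_a ∘ p_k`.** [cite: Lange2023AbelianVarietiesComplex, §1.1.4 Prop. 1.1.20 and §2.4.4 Thm. 2.4.25] -/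
theorem coord_sigmaPiPeriod (x : Σ k, σ k) :
    coord (sigmaPiPeriod Ψ) x = (coord (Ψ x.1) x.2).comp (ContinuousLinearMap.proj x.1) := by
  refine ContinuousLinearMap.ext fun w ↦ ?_
  rw [ContinuousLinearMap.comp_apply, coord_apply, coord_apply]
  rfl

/-- Renaming the alphabet of a wedge word: `(θ ∘ φ)_w = θ_{φ ∘ w}`. [folklore] -/
private theorem wedgeWord_comp_alphabet' {V : Type*} [NormedAddCommGroup V] [NormedSpace ℝ V] {α α' : Type*}
    (θ : α → (V →L[ℝ] ℂ)) (φ : α' → α) (c : V [⋀^Fin 0]→L[ℝ] ℂ) :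
    ∀ (k : ℕ) (w : Fin k → α'), wedgeWord (θ ∘ φ) c k w = wedgeWord θ c k (φ ∘ w)
  | 0, _ => rfl
  | k + 1, w => by
    rw [wedgeWord_succ, wedgeWord_succ, wedgeWord_comp_alphabet' θ φ c k (Fin.tail w)]
    rfl

omit [DecidableEq κ] [∀ k, DecidableEq (σ k)] in
/-- **`p_k^*(dx^k_{T-pairs}) = dx_{(k,T)-pairs}`**: the pull-back along `p_k` of an interleaved monomial of `C_k` is the
interleaved monomial of the same pairs of the product basis. [cite: Lange2023AbelianVarietiesComplex, §1.1.4 Prop. 1.1.20 and §2.4.4 Thm. 2.4.25] -/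
theorem latMonomial_ilvWord_compContinuousLinearMap_proj (k : κ) {q : ℕ} (t : Fin q → Fin (g k)) :
    (latMonomial (Ψ k) (2 * q) (ilvWord (e k) t)).compContinuousLinearMap
        (ContinuousLinearMap.proj k : (∀ l, F l) →L[ℝ] F k) =
      latMonomial (sigmaPiPeriod Ψ) (2 * q) (ilvWord (sigmaEnum e ε) (sigmaEmb ε k ∘ t)) := by
  rw [latMonomial_eq, latMonomial_eq, wedgeWord_compContinuousLinearMap, constOfIsEmpty_compContinuousLinearMap]
  have hθ : (fun a : σ k ↦ ((coord (Ψ k) a).smulRight (1 : ℂ)).comp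
      (ContinuousLinearMap.proj k : (∀ l, F l) →L[ℝ] F k)) =
      (fun x : Σ l, σ l ↦ (coord (sigmaPiPeriod Ψ) x).smulRight (1 : ℂ)) ∘ Sigma.mk k := by
    funext a; rw [Function.comp_apply, coord_sigmaPiPeriod]; rfl
  -- the word `ilvWord (sigmaEnum e ε) (sigmaEmb ε k ∘ t)` is `(k, ·) ∘ ilvWord (e k) t`
  have hw : ilvWord (sigmaEnum e ε) (sigmaEmb ε k ∘ t) = Sigma.mk k ∘ ilvWord (e k) t := by
    funext m
    rw [ilvWord_apply, Function.comp_apply, ilvWord_apply]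
    cases finTwoMulEquivSum q m with
    | inl i => rw [Sum.map_inl, Sum.map_inl, Function.comp_apply, sigmaEnum_inl_sigmaEmb]
    | inr i => rw [Sum.map_inr, Sum.map_inr, Function.comp_apply, sigmaEnum_inr_sigmaEmb]
  rw [hθ, wedgeWord_comp_alphabet', hw]

omit [DecidableEq κ] [∀ k, DecidableEq (σ k)] in
/-- `p_k^* ω^k_a = ω_{(k,a)}` for the pair forms. [cite: Lange2023AbelianVarietiesComplex, §1.1.4 Prop. 1.1.20 and §2.4.4 Thm. 2.4.25] -/
theorem pairMonomial_compContinuousLinearMap_proj (k : κ) (a : Fin (g k)) :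
    (pairMonomial (Ψ k) (e k) a).compContinuousLinearMap (ContinuousLinearMap.proj k : (∀ l, F l) →L[ℝ] F k) =
      pairMonomial (sigmaPiPeriod Ψ) (sigmaEnum e ε) (sigmaEmb ε k a) :=
  latMonomial_ilvWord_compContinuousLinearMap_proj Ψ e ε k fun _ : Fin 1 ↦ a

/-- **The block form of the factor `k` is its pulled-back polarisation form: `θ_k = p_k^*E_k`** (for the product
symplectic basis of types `d^k`, blocks = factors; `E_k = ofRealForm ω_k`).
[cite: Bertrand1997DualityTori, §3 (b) (p. 213: "`λ = p₁^*λ₁ + ⋯ + p_n^*λ_n`, where `p_i` is the projection from `A` to `C_i`")] [cite: Lange2023AbelianVarietiesComplex, §2.4.4 Cor. 2.4.24] -/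
theorem IsSymplecticEnum.blockTwoForm_sigmaPi (k : κ) (h : IsSymplecticEnum (Ψ k) (e k) (ω k) (d k)) :
    blockTwoForm (sigmaPiPeriod Ψ) (sigmaEnum e ε) (sigmaType ε d) (sigmaFactor ε) k =
      ofRealForm ((ω k).compContinuousLinearMap (ContinuousLinearMap.proj k : (∀ l, F l) →L[ℝ] F k)) := by
  classical
  rw [ofRealForm_compContinuousLinearMap, h.ofRealForm_eq_sum_pairMonomial (Ψ k) (e k) (d k), blockTwoForm]
  have hite : ∀ ν, (if sigmaFactor ε ν = k then ((sigmaType ε d ν : ℕ) : ℂ) else 0) •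
      pairMonomial (sigmaPiPeriod Ψ) (sigmaEnum e ε) ν =
      if sigmaFactor ε ν = k then ((sigmaType ε d ν : ℕ) : ℂ) • pairMonomial (sigmaPiPeriod Ψ) (sigmaEnum e ε) ν
      else 0 := fun ν ↦ by
    split_ifs
    · rfl
    · ext v; simp
  simp_rw [hite]
  rw [← Finset.sum_filter, filter_sigmaFactor_eq_image,
    Finset.sum_image fun a _ b _ hab ↦ sigmaEmb_injective ε k hab]
  simp only [sigmaType_sigmaEmb]
  have hlin : (∑ a, ((d k a : ℕ) : ℂ) • pairMonomial (Ψ k) (e k) a).compContinuousLinearMap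
      (ContinuousLinearMap.proj k : (∀ l, F l) →L[ℝ] F k) =
      ∑ a, ((d k a : ℕ) : ℂ) • (pairMonomial (Ψ k) (e k) a).compContinuousLinearMap
        (ContinuousLinearMap.proj k : (∀ l, F l) →L[ℝ] F k) := by
    ext v
    simp [ContinuousAlternatingMap.sum_apply]
  rw [hlin]
  exact Finset.sum_congr rfl fun a _ ↦ by rw [pairMonomial_compContinuousLinearMap_proj Ψ e ε k a]

/-- Principal factors: `θ_k = p_k^*E_k` for the type `(1, …, 1)`. [cite: Bertrand1997DualityTori, §3 (b) (p. 213)] -/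
theorem IsSymplecticEnum.blockTwoForm_sigmaPi_of_principal (k : κ) (h : IsSymplecticEnum (Ψ k) (e k) (ω k) fun _ ↦ 1) :
    blockTwoForm (sigmaPiPeriod Ψ) (sigmaEnum e ε) (fun _ ↦ 1) (sigmaFactor ε) k =
      ofRealForm ((ω k).compContinuousLinearMap (ContinuousLinearMap.proj k : (∀ l, F l) →L[ℝ] F k)) :=
  h.blockTwoForm_sigmaPi Ψ ω e ε k (d := fun _ _ ↦ 1)

/-! ## §4 Bertrand's Corollary for `(A, λ) = ∏_k (C_k, λ_k)`, on forms, for every cycle -/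

/-- **Bertrand's Corollary for `(A, λ) = ∏_{k ∈ κ} (C_k, λ_k)`, on forms, for every cycle**: for principally
polarised tori `(C_k, ω_k)` with principal symplectic bases `e_k`, words `c : Fin q → κ`, `c′ : Fin p → κ` in the
FACTORS with complementary multiplicities `r_k + r′_k = g_k = dim C_k` for every `k` (`J′ = (c_k − r_k)_k`,
`p + q = a = Σ g_k`), and every `σ ∈ H_{2q}(A, ℤ)`:
`(∏_k r_k!) · ∫_A ch^{c′} ∧ λ♭(σ) = (∏_k r′_k!) · ∫_σ ch^{c}`, where the factors of `ch^{c}` are the Chern forms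
`c₁(p_k^*L_k) = -θ_k = -p_k^*E_k` (`IsSymplecticEnum.blockTwoForm_sigmaPi_of_principal`) — for `σ = [B]`,
`B ⊆ A` an abelian subvariety of dimension `b = q` (`λ♭([B]) = ±[B^⊥]`, the tree's duality theorem
`IsPrincipalPolarization.torusIntegral_wedge_polFlat_eq_cycleIntegral`), this reads
"`deg_J(B)/r₁!⋯r_n! = deg_{J′}(B^⊥)/r′₁!⋯r′_n!`". [cite: Bertrand1997DualityTori, §3 (b) Corollary (p. 214)] -/
theorem IsSymplecticEnum.prod_factorial_mul_torusIntegral_chern_wedge_polFlat_sigmaPi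
    (h : ∀ k, IsSymplecticEnum (Ψ k) (e k) (ω k) fun _ ↦ 1) (hp : ∀ k, IsPrincipalPolarization (Ψ k) (ω k))
    {p q : ℕ} (hm : q + p = G) (eo : Fin (2 * p + 2 * q) ≃ (Σ k, σ k)) {c : Fin q → κ} {c' : Fin p → κ}
    (hcc' : ∀ k, wordMult c k + wordMult c' k = g k) (τ : ⋀[ℤ]^(2 * q) ((Σ k, σ k) → ℤ)) :
    (∏ k, ((wordMult c k).factorial : ℂ)) *
        torusIntegral (sigmaPiPeriod Ψ) eo ((wedgeFamily p fun j ↦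
          -blockTwoForm (sigmaPiPeriod Ψ) (sigmaEnum e ε) (fun _ ↦ 1) (sigmaFactor ε) (c' j)).wedge
            (polFlat (sigmaPiPeriod Ψ) (piForm ω) (2 * q) τ)) =
      (∏ k, ((wordMult c' k).factorial : ℂ)) *
        cycleIntegral (sigmaPiPeriod Ψ) (2 * q) τ (wedgeFamily q fun j ↦
          -blockTwoForm (sigmaPiPeriod Ψ) (sigmaEnum e ε) (fun _ ↦ 1) (sigmaFactor ε) (c j)) := by
  letI : LinearOrder (Σ k, σ k) := linearOrderOfOrientation eo
  obtain ⟨Gm, hGm⟩ := exists_intMatrix_latticeGram (sigmaPiPeriod Ψ) (piForm ω)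
    (IsPrincipalPolarization.sigmaPi hp).isRiemannForm.2.1
  have hm' : q + p = Fintype.card (Fin G) := by rw [Fintype.card_fin]; exact hm
  exact (IsSymplecticEnum.sigmaPi_of_principal Ψ ω e ε h).prod_factorial_mul_torusIntegral_chern_wedge_polFlat_of_principal
    (sigmaPiPeriod Ψ) (IsPrincipalPolarization.sigmaPi hp) hGm hm' eo (sigmaFactor ε)
    (fun k ↦ by rw [card_filter_sigmaFactor]; exact hcc' k) τ

/-- **The same with the Chern forms written as pull-backs, `c₁(p_k^*L_k) = -p_k^*E_k`:**
`(∏_k r_k!) · ∫_A (∧_j -p_{c′ j}^*E_{c′ j}) ∧ λ♭(σ) = (∏_k r′_k!) · ∫_σ ∧_j (-p_{c j}^*E_{c j})`.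
[cite: Bertrand1997DualityTori, §3 (b) Corollary (p. 214: "`deg_J(W) = (W · p₁^*λ₁^{r₁} ⋯ p_n^*λ_n^{r_n})`")] -/
theorem IsSymplecticEnum.prod_factorial_mul_torusIntegral_pullback_wedge_polFlat_sigmaPi
    (h : ∀ k, IsSymplecticEnum (Ψ k) (e k) (ω k) fun _ ↦ 1) (hp : ∀ k, IsPrincipalPolarization (Ψ k) (ω k))
    {p q : ℕ} (hm : q + p = ∑ k, g k) (eo : Fin (2 * p + 2 * q) ≃ (Σ k, σ k)) {c : Fin q → κ} {c' : Fin p → κ}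
    (hcc' : ∀ k, wordMult c k + wordMult c' k = g k) (τ : ⋀[ℤ]^(2 * q) ((Σ k, σ k) → ℤ)) :
    (∏ k, ((wordMult c k).factorial : ℂ)) *
        torusIntegral (sigmaPiPeriod Ψ) eo ((wedgeFamily p fun j ↦
          -ofRealForm ((ω (c' j)).compContinuousLinearMap
            (ContinuousLinearMap.proj (c' j) : (∀ l, F l) →L[ℝ] F (c' j)))).wedge
            (polFlat (sigmaPiPeriod Ψ) (piForm ω) (2 * q) τ)) =
      (∏ k, ((wordMult c' k).factorial : ℂ)) *
        cycleIntegral (sigmaPiPeriod Ψ) (2 * q) τ (wedgeFamily q fun j ↦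
          -ofRealForm ((ω (c j)).compContinuousLinearMap
            (ContinuousLinearMap.proj (c j) : (∀ l, F l) →L[ℝ] F (c j)))) := by
  -- number the pairs of the product basis by any bijection `Fin (Σ g_k) ≃ Σ_k [g_k]`
  have hcard : Fintype.card (Fin (∑ k, g k)) = Fintype.card (Σ k, Fin (g k)) := by
    rw [Fintype.card_fin, Fintype.card_sigma]
    simp only [Fintype.card_fin]
  let ε : Fin (∑ k, g k) ≃ Σ k, Fin (g k) := Fintype.equivOfCardEq hcard
  have hθ : ∀ k, blockTwoForm (sigmaPiPeriod Ψ) (sigmaEnum e ε) (fun _ ↦ 1) (sigmaFactor ε) k =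
      ofRealForm ((ω k).compContinuousLinearMap (ContinuousLinearMap.proj k : (∀ l, F l) →L[ℝ] F k)) :=
    fun k ↦ (h k).blockTwoForm_sigmaPi_of_principal Ψ ω e ε k
  have key := IsSymplecticEnum.prod_factorial_mul_torusIntegral_chern_wedge_polFlat_sigmaPi Ψ ω e ε h hp hm eo
    hcc' τ
  simp only [hθ] at key
  exact key

end SigmaPi

/-! ### Bertrand's numbering `i = 1, …, n`: `(A, λ) = ∏_{i=1}^n (C_i, λ_i)`, `a = c₁ + ⋯ + c_n` -/

section FinSigmaCorollary

variable {n : ℕ} {σ : Fin n → Type*} [∀ k, Fintype (σ k)] [∀ k, DecidableEq (σ k)]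
  {F : Fin n → Type*} [∀ k, NormedAddCommGroup (F k)] [∀ k, NormedSpace ℂ (F k)]
  (Ψ : ∀ k, (σ k → ℝ) ≃L[ℝ] F k) (ω : ∀ k, F k [⋀^Fin 2]→L[ℝ] ℝ) {g : Fin n → ℕ}
  (e : ∀ k, Fin (g k) ⊕ Fin (g k) ≃ σ k)

/-- **Bertrand's Corollary for `(A, λ) = ∏_{i=1}^n (C_i, λ_i)`** with the pairs numbered factor by factor
(`finSigmaEnum`, `a = dim A = c₁ + ⋯ + c_n` literally): `(∏ r_i!) · ∫_A ch^{J′} ∧ λ♭(σ) = (∏ r′_i!) · ∫_σ ch^{J}`.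
[cite: Bertrand1997DualityTori, §3 (b) Corollary (p. 214: "Let `(A, λ) = ∏_{i=1}^n (C_i, λ_i)` be a principally polarized abelian variety … Then, `deg_J(B)/r₁!⋯r_n! = deg_{J′}(B^⊥)/r′₁!⋯r′_n!`")] -/
theorem IsSymplecticEnum.prod_factorial_mul_torusIntegral_chern_wedge_polFlat_finSigma
    (h : ∀ k, IsSymplecticEnum (Ψ k) (e k) (ω k) fun _ ↦ 1) (hp : ∀ k, IsPrincipalPolarization (Ψ k) (ω k))
    {p q : ℕ} (hm : q + p = ∑ i, g i) (eo : Fin (2 * p + 2 * q) ≃ (Σ k, σ k)) {c : Fin q → Fin n}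
    {c' : Fin p → Fin n} (hcc' : ∀ k, wordMult c k + wordMult c' k = g k) (τ : ⋀[ℤ]^(2 * q) ((Σ k, σ k) → ℤ)) :
    (∏ k, ((wordMult c k).factorial : ℂ)) *
        torusIntegral (sigmaPiPeriod Ψ) eo ((wedgeFamily p fun j ↦
          -blockTwoForm (sigmaPiPeriod Ψ) (finSigmaEnum e) (fun _ ↦ 1) (sigmaFactor finSigmaFinEquiv.symm)
            (c' j)).wedge (polFlat (sigmaPiPeriod Ψ) (piForm ω) (2 * q) τ)) =
      (∏ k, ((wordMult c' k).factorial : ℂ)) *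
        cycleIntegral (sigmaPiPeriod Ψ) (2 * q) τ (wedgeFamily q fun j ↦
          -blockTwoForm (sigmaPiPeriod Ψ) (finSigmaEnum e) (fun _ ↦ 1) (sigmaFactor finSigmaFinEquiv.symm)
            (c j)) :=
  IsSymplecticEnum.prod_factorial_mul_torusIntegral_chern_wedge_polFlat_sigmaPi Ψ ω e finSigmaFinEquiv.symm h hp hm
    eo hcc' τ

end FinSigmaCorollary

/-! ## §5 Newton's formula grouped by multidegrees: `E^{∧b} = Σ_J c(J) θ^J`, `c(J) = b!/r₁!⋯r_n!` -/

section NewtonMultinomial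

variable {β : Type*} [Fintype β] [DecidableEq β] {b : ℕ}

omit [Fintype β] in
/-- **The word of blocks of a `Σ`-numbering has the prescribed multiplicities**: `J(blk) = (g_k)_k`.
[cite: Bertrand1997DualityTori, §3 (b) (p. 213: "`b := r₁ + ⋯ + r_n`")] -/
theorem wordMult_sigmaFactor {g : β → ℕ} (ε : Fin b ≃ Σ k, Fin (g k)) : wordMult (sigmaFactor ε) = g :=
  funext fun k ↦ card_filter_sigmaFactor ε k

/-- **Every multiplicity vector `J = (r_i)` with `Σ r_i = b` is the multiplicity vector of a word `c : Fin b → β`**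
(number `⊔_i [r_i]` by `Fin b`). [cite: Bertrand1997DualityTori, §3 (b) (p. 213: "let `J = {r₁, …, r_n}` be a set of integers … `b := r₁ + ⋯ + r_n`")] -/
theorem exists_wordMult_eq (J : β → ℕ) (hJ : ∑ i, J i = b) : ∃ c : Fin b → β, wordMult c = J := by
  have hcard : Fintype.card (Fin b) = Fintype.card (Σ i, Fin (J i)) := by
    rw [Fintype.card_fin, Fintype.card_sigma]
    simp only [Fintype.card_fin]
    exact hJ.symm
  exact ⟨sigmaFactor (Fintype.equivOfCardEq hcard), wordMult_sigmaFactor _⟩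

/-- The multiplicity vectors of words of length `b` are the `J` with `|J| = b` (`wordMult` maps into
`piAntidiag univ b`). [cite: Bertrand1997DualityTori, §3 (b) (p. 213)] -/
theorem wordMult_mem_piAntidiag (c : Fin b → β) : wordMult c ∈ (univ : Finset β).piAntidiag b := by
  rw [Finset.mem_piAntidiag]
  exact ⟨sum_wordMult c, fun i _ ↦ Finset.mem_univ i⟩

/-- **There is a choice `J ↦ w(J)` of a word for every multiplicity vector** (for `β` nonempty; used to write
Newton's formula as a sum over the `J`). [cite: Bertrand1997DualityTori, §3 (b) (p. 214)] -/
theorem exists_forall_wordMult_eq [Nonempty β] (b : ℕ) :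
    ∃ w : (β → ℕ) → (Fin b → β), ∀ J ∈ (univ : Finset β).piAntidiag b, wordMult (w J) = J := by
  classical
  refine ⟨fun J ↦ if hJ : ∑ i, J i = b then (exists_wordMult_eq J hJ).choose else fun _ ↦ Classical.arbitrary β,
    fun J hJ ↦ ?_⟩
  have hJ' : ∑ i, J i = b := (Finset.mem_piAntidiag.1 hJ).1
  simp only [hJ', dif_pos]
  exact (exists_wordMult_eq J hJ').choose_spec

omit [Fintype β] in
/-- Two words with the same multiplicities are permutations of each other (glue fibrewise bijections). [folklore] -/
private theorem exists_perm_comp_eq_of_wordMult_eq' {u c : Fin b → β} (h : wordMult u = wordMult c) :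
    ∃ π : Equiv.Perm (Fin b), u ∘ ⇑π = c := by
  have e : ∀ i, {j // c j = i} ≃ {j // u j = i} := fun i ↦
    Fintype.equivOfCardEq (by rw [← wordMult_eq_card_subtype, ← wordMult_eq_card_subtype, h])
  exact ⟨Equiv.ofFiberEquiv e, funext fun j ↦ Equiv.ofFiberEquiv_map e j⟩

/-- **The multinomial count `c(J) = #{c | J(c) = J} = b!/r₁!⋯r_n!`** (Mathlib's `Nat.multinomial univ J`; from the
tree's orbit–stabiliser count `card_filter_wordMult_eq_mul : #{c′ | J(c′) = J(c)} · ∏ r_i! = b!`).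
[cite: Bona2011, Thm. 3.5 (chunk p0050 L7: "the number of ways to linearly order these objects is `n!/(a₁!⋯a_k!)`")] [cite: Bertrand1997DualityTori, §3 (b) (p. 214: "`c(J)` is the binomial coefficient `b!/r₁!…r_n!`")] -/
theorem card_filter_wordMult_eq_multinomial (c : Fin b → β) :
    (univ.filter fun c' : Fin b → β ↦ wordMult c' = wordMult c).card = Nat.multinomial univ (wordMult c) := by
  have h := card_filter_wordMult_eq_mul c
  have hfilter : (univ.filter fun c' : Fin b → β ↦ ∀ i, wordMult c' i = wordMult c i) =
      univ.filter fun c' : Fin b → β ↦ wordMult c' = wordMult c :=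
    Finset.filter_congr fun c' _ ↦ funext_iff.symm
  have hspec := Nat.multinomial_spec (univ : Finset β) (wordMult c)
  rw [sum_wordMult c] at hspec
  rw [hfilter] at h
  exact Nat.eq_of_mul_eq_mul_right (Finset.prod_pos fun i _ ↦ Nat.factorial_pos (wordMult c i))
    (h.trans (hspec.symm.trans (mul_comm _ _)))

variable {ι : Type*} [Fintype ι] {E : Type uF} [NormedAddCommGroup E] [NormedSpace ℂ E] (Φ : (ι → ℝ) ≃L[ℝ] E)
  {g : ℕ} (e₀ : Fin g ⊕ Fin g ≃ ι) {η : E [⋀^Fin 2]→L[ℝ] ℝ} (d : Fin g → ℕ) (blk : Fin g → β)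

omit [Fintype ι] in
/-- **The words of one multiplicity class all give the same monomial, `Σ_{J(c′) = J(c)} θ^{c′} = c(J) · θ^{c}`**
(`2`-forms commute: `θ^{c ∘ π} = θ^{c}`, `blockPow_comp_perm`). [cite: Bertrand1997DualityTori, §3 (b) (p. 214: "`deg_J(W) = (W · p₁^*λ₁^{r₁} ⋯ p_n^*λ_n^{r_n})`")] -/
theorem sum_filter_wordMult_blockPow (c : Fin b → β) :
    ∑ c' ∈ univ.filter (fun c' : Fin b → β ↦ wordMult c' = wordMult c), blockPow Φ e₀ d blk c' =
      (Nat.multinomial univ (wordMult c) : ℂ) • blockPow Φ e₀ d blk c := by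
  have hconst : ∀ c' ∈ univ.filter (fun c' : Fin b → β ↦ wordMult c' = wordMult c),
      blockPow Φ e₀ d blk c' = blockPow Φ e₀ d blk c := by
    intro c' hc'
    obtain ⟨π, hπ⟩ := exists_perm_comp_eq_of_wordMult_eq' ((Finset.mem_filter.1 hc').2).symm
    rw [← hπ, blockPow_comp_perm]
  rw [Finset.sum_congr rfl hconst, Finset.sum_const, card_filter_wordMult_eq_multinomial, ← Nat.cast_smul_eq_nsmul ℂ]

/-- **Newton's formula grouped by multidegrees: `E^{∧b} = Σ_{|J| = b} c(J) · θ^{J}`**, `c(J) = b!/r₁!⋯r_n!`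
(`Nat.multinomial univ J`), the sum over the multiplicity vectors `J ∈ piAntidiag univ b` and `θ^J = θ^{w(J)}` for any
choice of words `w(J)` with `J(w(J)) = J` (`exists_forall_wordMult_eq`) — the form-level identity behind
"`deg_λ(W) = Σ_J c(J) deg_J(W)`, where `J` runs through all sets of `n`-tuples `{r₁, …, r_n}` … and `c(J)` is the binomial
coefficient `b!/r₁!⋯r_n!`" (regroup the word form `E^{∧b} = Σ_c θ^{c}` of the tree by `J(c)`).
[cite: Bertrand1997DualityTori, §3 (b) (p. 214, Newton's formula)] -/
theorem IsSymplecticEnum.wedgePow_eq_sum_piAntidiag_multinomial_smul_blockPow [DecidableEq ι]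
    (hs : IsSymplecticEnum Φ e₀ η d) (b : ℕ) (w : (β → ℕ) → (Fin b → β)) (hw : ∀ J ∈ (univ : Finset β).piAntidiag b, wordMult (w J) = J) :
    wedgePow (ofRealForm η) b =
      ∑ J ∈ (univ : Finset β).piAntidiag b, (Nat.multinomial univ J : ℂ) • blockPow Φ e₀ d blk (w J) := by
  rw [hs.wedgePow_eq_sum_blockPow Φ e₀ d blk b,
    ← Finset.sum_fiberwise_of_maps_to (fun c (_ : c ∈ univ) ↦ wordMult_mem_piAntidiag (β := β) c)]
  refine Finset.sum_congr rfl fun J hJ ↦ ?_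
  rw [← hw J hJ, sum_filter_wordMult_blockPow, hw J hJ]

/-- **Newton's formula for the Chern forms**: `c₁(L)^{∧b} = Σ_{|J| = b} c(J) · ch^{J}` with `c₁(L) = -E` and
`ch^{J} = ∧_j (-θ_{w(J) j})` (both sides carry `(-1)^b`). [cite: Bertrand1997DualityTori, §3 (b) (p. 214, Newton's formula)] [cite: Lange2023AbelianVarietiesComplex, §1.7.2 Lemma 1.7.4 (`c₁(L) = -E`)] -/
theorem IsSymplecticEnum.wedgePow_neg_eq_sum_piAntidiag_multinomial_smul_chern [DecidableEq ι]
    (hs : IsSymplecticEnum Φ e₀ η d)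
    (b : ℕ) (w : (β → ℕ) → (Fin b → β)) (hw : ∀ J ∈ (univ : Finset β).piAntidiag b, wordMult (w J) = J) :
    wedgePow (-ofRealForm η) b =
      ∑ J ∈ (univ : Finset β).piAntidiag b,
        (Nat.multinomial univ J : ℂ) • wedgeFamily b fun j ↦ -blockTwoForm Φ e₀ d blk (w J j) := by
  rw [wedgePow_neg, hs.wedgePow_eq_sum_piAntidiag_multinomial_smul_blockPow Φ e₀ d blk b w hw, Finset.smul_sum]
  exact Finset.sum_congr rfl fun J _ ↦ by rw [wedgeFamily_neg_blockTwoForm, smul_comm]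

variable [LinearOrder ι]

/-- **`deg_λ(W) = Σ_J c(J) deg_J(W)` on cycles**: `∫_σ E^{∧b} = Σ_{|J| = b} c(J) ∫_σ θ^{J}` for every
`σ ∈ H_{2b}(X, ℤ)` (for `σ = [W]`: `∫_W c₁(L)^{∧b} = (-1)^b ∫_W E^{∧b}` and `∫_W ch^{J} = (-1)^b ∫_W θ^J` carry the
same sign). [cite: Bertrand1997DualityTori, §3 (b) (p. 214: "`deg_λ(W) = Σ_J c(J) deg_J(W)`")] -/
theorem IsSymplecticEnum.cycleIntegral_wedgePow_eq_sum_piAntidiag_multinomial (hs : IsSymplecticEnum Φ e₀ η d)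
    (b : ℕ) (w : (β → ℕ) → (Fin b → β)) (hw : ∀ J ∈ (univ : Finset β).piAntidiag b, wordMult (w J) = J)
    (τ : ⋀[ℤ]^(2 * b) (ι → ℤ)) :
    cycleIntegral Φ (2 * b) τ (wedgePow (ofRealForm η) b) =
      ∑ J ∈ (univ : Finset β).piAntidiag b,
        (Nat.multinomial univ J : ℂ) * cycleIntegral Φ (2 * b) τ (blockPow Φ e₀ d blk (w J)) := by
  rw [hs.wedgePow_eq_sum_piAntidiag_multinomial_smul_blockPow Φ e₀ d blk b w hw, map_sum]
  exact Finset.sum_congr rfl fun J _ ↦ by rw [map_smul, smul_eq_mul]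

end NewtonMultinomial

/-! ## §6 Bertrand's auxiliary polarisations `λ_z = z₁p₁^*λ₁ + ⋯ + z_n p_n^*λ_n` and the diagonal isogeny `t_z`

"PROOF. To any `n`-tuple of variable positive integers `z = (z₁, …, z_n)`, we associate the polarization
`λ_z = z₁p₁^*λ₁ + ⋯ + z_n p_n^*λ_n` on `A`. The corresponding isogeny from `A` to its dual `A^∨` (which we identify with
`A` thanks to the principal polarization `λ`) is the 'diagonal' map `t_z = (z₁, …, z_n)` on `C₁ × ⋯ × C_n`, whose kernel
`A[t_z]` has order `z₁^{2c₁}⋯z_n^{2c_n}`." [cite: Bertrand1997DualityTori, §3 (b), proof of the Corollary (p. 214)] -/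

section Weights

variable {κ : Type*} [Fintype κ] [DecidableEq κ] {σ : κ → Type*} [∀ k, Fintype (σ k)] [∀ k, DecidableEq (σ k)]
  {F : κ → Type*} [∀ k, NormedAddCommGroup (F k)] [∀ k, NormedSpace ℂ (F k)]
  (Ψ : ∀ k, (σ k → ℝ) ≃L[ℝ] F k) (ω : ∀ k, F k [⋀^Fin 2]→L[ℝ] ℝ) (z : κ → ℕ)

/-- `(M N)_ℝ = M_ℝ N_ℝ`. [folklore] -/
private theorem map_mul_intCast'' {m n o : Type*} [Fintype n] (M : Matrix m n ℤ) (N : Matrix n o ℤ) :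
    (M * N).map (Int.cast : ℤ → ℝ) = M.map (Int.cast : ℤ → ℝ) * N.map (Int.cast : ℤ → ℝ) :=
  Matrix.map_mul (f := Int.castRingHom ℝ)

omit [DecidableEq κ] [∀ k, DecidableEq (σ k)] in
/-- **`λ_z = Σ_k z_k p_k^*λ_k` is a polarisation of `A = ∏ C_k` for positive integer weights `z_k`.**
[cite: Bertrand1997DualityTori, §3 (b), proof of the Corollary (p. 214: "we associate the polarization `λ_z = z₁p₁^*λ₁ + ⋯ + z_n p_n^*λ_n` on `A`")] -/
theorem IsRiemannForm.piForm_natCast_smul {Ψ : ∀ k, (σ k → ℝ) ≃L[ℝ] F k} {ω : ∀ k, F k [⋀^Fin 2]→L[ℝ] ℝ}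
    (h : ∀ k, IsRiemannForm (Ψ k) (ω k)) {z : κ → ℕ} (hz : ∀ k, 0 < z k) :
    IsRiemannForm (sigmaPiPeriod Ψ) (piForm fun k ↦ (z k : ℝ) • ω k) :=
  IsRiemannForm.sigmaPi fun k ↦ IsRiemannForm.natCast_smul (h k) (hz k)

/-- **The Gram matrix of `λ_z` is `diag(z_k G_k)`.** [cite: Bertrand1997DualityTori, §3 (b), proof of the Corollary (p. 214)] -/
theorem latticeGram_piForm_smul :
    latticeGram (sigmaPiPeriod Ψ) (piForm fun k ↦ (z k : ℝ) • ω k) =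
      Matrix.blockDiagonal' fun k ↦ (z k : ℝ) • latticeGram (Ψ k) (ω k) := by
  rw [latticeGram_sigmaPi]
  exact congrArg Matrix.blockDiagonal' (funext fun k ↦ latticeGram_smul (Ψ k) (z k : ℝ) (ω k))

/-- **`φ_{λ_z} = φ_λ ∘ t_z`: the Gram matrix of `λ_z` is the Gram matrix of `λ` times the diagonal matrix
`diag(z_k · 1)`** (the rational representation of `t_z = (z₁, …, z_n)`).
[cite: Bertrand1997DualityTori, §3 (b), proof of the Corollary (p. 214: "The corresponding isogeny from `A` to its dual … is the 'diagonal' map `t_z = (z₁, …, z_n)`")] -/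
theorem latticeGram_piForm_smul_eq_mul :
    latticeGram (sigmaPiPeriod Ψ) (piForm fun k ↦ (z k : ℝ) • ω k) =
      latticeGram (sigmaPiPeriod Ψ) (piForm ω) *
        Matrix.blockDiagonal' fun k ↦ (z k : ℝ) • (1 : Matrix (σ k) (σ k) ℝ) := by
  rw [latticeGram_piForm_smul, latticeGram_sigmaPi, ← Matrix.blockDiagonal'_mul]
  congr 1
  funext k
  rw [Matrix.mul_smul, Matrix.mul_one]

variable {G : ∀ k, Matrix (σ k) (σ k) ℤ}

/-- **The integer Gram matrix of `λ_z` is `diag(z_k G_k)`** for integer Gram matrices `G_k` of the `λ_k`.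
[cite: Bertrand1997DualityTori, §3 (b), proof of the Corollary (p. 214)] -/
theorem map_sigmaBlockMatrix_smul_eq_latticeGram (hG : ∀ k, (G k).map (Int.cast : ℤ → ℝ) = latticeGram (Ψ k) (ω k)) :
    (sigmaBlockMatrix fun k ↦ (z k : ℤ) • G k).map (Int.cast : ℤ → ℝ) =
      latticeGram (sigmaPiPeriod Ψ) (piForm fun k ↦ (z k : ℝ) • ω k) := by
  rw [latticeGram_piForm_smul, sigmaBlockMatrix, Matrix.blockDiagonal'_map _ _ Int.cast_zero]
  congr 1
  funext k
  rw [← hG k]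
  ext i j
  simp only [Matrix.map_apply, Matrix.smul_apply, smul_eq_mul, Int.cast_mul, Int.cast_natCast]

/-- **`|K(λ_z)| = ∏_k z_k^{rk Λ_k} · |det G_k|`** (`deg φ_{λ_z} = det diag(z_k G_k)`).
[cite: Bertrand1997DualityTori, §3 (b), proof of the Corollary (p. 214)] [cite: Lange2023AbelianVarietiesComplex, §1.4.2 Prop. 1.4.7] -/
theorem natCard_kerPhiH_sigmaBlockMatrix_smul (G : ∀ k, Matrix (σ k) (σ k) ℤ) :
    Nat.card (kerPhiH (sigmaPiPeriod Ψ) (sigmaBlockMatrix fun k ↦ (z k : ℤ) • G k)) =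
      ∏ k, z k ^ Fintype.card (σ k) * (G k).det.natAbs := by
  rw [natCard_kerPhiH, sigmaBlockMatrix, det_blockDiagonal'_eq_prod]
  have h := map_prod Int.natAbsHom (fun k ↦ ((z k : ℤ) • G k).det) univ
  rw [Int.natAbsHom_apply] at h
  rw [h]
  refine Finset.prod_congr rfl fun k _ ↦ ?_
  rw [Int.natAbsHom_apply, Matrix.det_smul, Int.natAbs_mul, Int.natAbs_pow, Int.natAbs_natCast]

/-- **Principal factors: `|K(λ_z)| = ∏_k z_k^{rk Λ_k}`** (`det G_k = 1`).
[cite: Bertrand1997DualityTori, §3 (b), proof of the Corollary (p. 214: "whose kernel `A[t_z]` has order `z₁^{2c₁}⋯z_n^{2c_n}`")] -/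
theorem IsPrincipalPolarization.natCard_kerPhiH_sigmaBlockMatrix_smul
    (hp : ∀ k, IsPrincipalPolarization (Ψ k) (ω k))
    (hG : ∀ k, (G k).map (Int.cast : ℤ → ℝ) = latticeGram (Ψ k) (ω k)) :
    Nat.card (kerPhiH (sigmaPiPeriod Ψ) (sigmaBlockMatrix fun k ↦ (z k : ℤ) • G k)) =
      ∏ k, z k ^ Fintype.card (σ k) := by
  rw [ComplexTorus.natCard_kerPhiH_sigmaBlockMatrix_smul Ψ z G]
  refine Finset.prod_congr rfl fun k _ ↦ ?_
  have h1 : ((G k).det : ℝ) = 1 := by rw [Int.cast_det, hG k, (hp k).det_latticeGram]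
  rw [Int.cast_eq_one] at h1
  rw [h1, Int.natAbs_one, mul_one]

/-- **The 'diagonal' map `t_z = (z₁, …, z_n)` on `C₁ × ⋯ × C_n` is an isogeny** (for `z_k ≠ 0`; its rational
representation is `diag(z_k · 1)`). [cite: Bertrand1997DualityTori, §3 (b), proof of the Corollary (p. 214)] [cite: Lange2023AbelianVarietiesComplex, §1.1.2 Lemma 1.1.11 and Prop. 1.1.14] -/
theorem isIsogeny_sigmaBlockMatrix_smul_one (hz : ∀ k, z k ≠ 0) :
    IsIsogeny (sigmaPiPeriod Ψ) (sigmaPiPeriod Ψ)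
      (sigmaBlockMatrix fun k ↦ (z k : ℤ) • (1 : Matrix (σ k) (σ k) ℤ)) :=
  IsIsogeny.sigmaPi Ψ Ψ fun k ↦ isIsogeny_smul_one (Ψ k) (by exact_mod_cast hz k)

/-- **`|A[t_z]| = ∏_k z_k^{rk Λ_k}`** ("whose kernel `A[t_z]` has order `z₁^{2c₁}⋯z_n^{2c_n}`", `rk Λ_k = 2c_k`).
[cite: Bertrand1997DualityTori, §3 (b), proof of the Corollary (p. 214)] [cite: Lange2023AbelianVarietiesComplex, §1.1.2 Prop. 1.1.14] -/
theorem natCard_ker_sigmaBlockMatrix_smul_one :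
    Nat.card (mapMatrixHom (sigmaPiPeriod Ψ) (sigmaPiPeriod Ψ)
        (sigmaBlockMatrix fun k ↦ (z k : ℤ) • (1 : Matrix (σ k) (σ k) ℤ))).ker =
      ∏ k, z k ^ Fintype.card (σ k) := by
  rw [natCard_ker_mapMatrixHom, sigmaBlockMatrix, det_blockDiagonal'_eq_prod]
  have h := map_prod Int.natAbsHom (fun k ↦ ((z k : ℤ) • (1 : Matrix (σ k) (σ k) ℤ)).det) univ
  rw [Int.natAbsHom_apply] at h
  rw [h]
  refine Finset.prod_congr rfl fun k _ ↦ ?_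
  rw [Int.natAbsHom_apply, Matrix.det_smul, Matrix.det_one, mul_one, Int.natAbs_pow, Int.natAbs_natCast]

/-- `|A[t_z]| = ∏_k z_k^{2 g_k}` when the factors have symplectic bases (`rk Λ_k = 2 g_k = 2 dim C_k`).
[cite: Bertrand1997DualityTori, §3 (b), proof of the Corollary (p. 214: "whose kernel `A[t_z]` has order `z₁^{2c₁}⋯z_n^{2c_n}`")] -/
theorem natCard_ker_sigmaBlockMatrix_smul_one_of_equiv {g : κ → ℕ} (e : ∀ k, Fin (g k) ⊕ Fin (g k) ≃ σ k) :
    Nat.card (mapMatrixHom (sigmaPiPeriod Ψ) (sigmaPiPeriod Ψ)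
        (sigmaBlockMatrix fun k ↦ (z k : ℤ) • (1 : Matrix (σ k) (σ k) ℤ))).ker =
      ∏ k, z k ^ (2 * g k) := by
  rw [natCard_ker_sigmaBlockMatrix_smul_one]
  refine Finset.prod_congr rfl fun k _ ↦ ?_
  rw [← Fintype.card_congr (e k), Fintype.card_sum, Fintype.card_fin, two_mul]

omit [DecidableEq κ] [∀ k, Fintype (σ k)] [∀ k, DecidableEq (σ k)] in
/-- A unimodular integer matrix preserves integrality: `U_ℝ y ∈ ℤ^ι ↔ y ∈ ℤ^ι` (`U^{-1}` is an integer matrix). [folklore] -/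
private theorem exists_map_mulVec_eq_intVec_iff_of_isUnit {ι : Type*} [Fintype ι] [DecidableEq ι] {U : Matrix ι ι ℤ}
    (hU : IsUnit U.det) (y : ι → ℝ) :
    (∃ n : ι → ℤ, U.map (Int.cast : ℤ → ℝ) *ᵥ y = intVec n) ↔ ∃ m : ι → ℤ, y = intVec m := by
  constructor
  · rintro ⟨n, hn⟩
    refine ⟨U⁻¹ *ᵥ n, ?_⟩
    calc y = ((U⁻¹ * U).map (Int.cast : ℤ → ℝ)) *ᵥ y := by
          rw [Matrix.nonsing_inv_mul U hU, Matrix.map_one Int.cast Int.cast_zero Int.cast_one, Matrix.one_mulVec]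
      _ = (U⁻¹).map (Int.cast : ℤ → ℝ) *ᵥ (U.map (Int.cast : ℤ → ℝ) *ᵥ y) := by
          rw [map_mul_intCast'', Matrix.mulVec_mulVec]
      _ = intVec (U⁻¹ *ᵥ n) := by rw [hn, intVec_mulVec]
  · rintro ⟨m, rfl⟩
    exact ⟨U *ᵥ m, intVec_mulVec U m⟩

/-- **`K(λ_z) = A[t_z]` for principal factors**: with unimodular Gram matrices `G_k` (principal `λ_k`, the
identification `A^∨ = A` "thanks to the principal polarization `λ`"), the kernel of `φ_{λ_z}` is the kernel of the
diagonal map `t_z = (z₁, …, z_n)`. [cite: Bertrand1997DualityTori, §3 (b), proof of the Corollary (p. 214: "The corresponding isogeny from `A` to its dual `A^∨` (which we identify with `A` thanks to the principal polarization `λ`) is the 'diagonal' map `t_z`")] -/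
theorem kerPhiH_sigmaBlockMatrix_smul_eq_ker (hGu : ∀ k, IsUnit (G k).det) :
    kerPhiH (sigmaPiPeriod Ψ) (sigmaBlockMatrix fun k ↦ (z k : ℤ) • G k) =
      (mapMatrixHom (sigmaPiPeriod Ψ) (sigmaPiPeriod Ψ)
        (sigmaBlockMatrix fun k ↦ (z k : ℤ) • (1 : Matrix (σ k) (σ k) ℤ))).ker := by
  ext t
  obtain ⟨x, rfl⟩ : ∃ x, proj (sigmaPiPeriod Ψ) x = t := ⟨lift _ t, proj_lift _ t⟩
  rw [kerPhiH, proj_mem_ker_mapMatrixHom_iff, proj_mem_ker_mapMatrixHom_iff]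
  -- `ᵗdiag(z_k G_k) = diag(ᵗG_k) · diag(z_k 1)` with `diag(ᵗG_k)` unimodular
  have hT : (sigmaBlockMatrix fun k ↦ (z k : ℤ) • G k).transpose =
      sigmaBlockMatrix (fun k ↦ (G k).transpose) *
        sigmaBlockMatrix fun k ↦ (z k : ℤ) • (1 : Matrix (σ k) (σ k) ℤ) := by
    rw [sigmaBlockMatrix, sigmaBlockMatrix, sigmaBlockMatrix, Matrix.blockDiagonal'_transpose,
      ← Matrix.blockDiagonal'_mul]
    congr 1
    funext k
    rw [Matrix.transpose_smul, Matrix.mul_smul, Matrix.mul_one]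
  have hU : IsUnit (sigmaBlockMatrix fun k ↦ (G k).transpose).det := by
    rw [sigmaBlockMatrix, det_blockDiagonal'_eq_prod]
    exact IsUnit.prod_univ_iff.2 fun k ↦ by rw [Matrix.det_transpose]; exact hGu k
  rw [hT, map_mul_intCast'', ← Matrix.mulVec_mulVec, exists_map_mulVec_eq_intVec_iff_of_isUnit hU]

/-! ## §7 `E_{λ_z} = Σ_k z_k θ_k` and Newton's formula with weights: `deg_{λ_z}(W) = Σ_J c(J) z^J deg_J(W)`

"Applying Theorem 3 (in the shape above) to the orthogonal complement `B_z` of `B` with respect to `λ_z`, together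
with Newton's formula, we obtain: … `Σ_J c(J′) deg_{J′}(B_z^z) z^{J′}` … where we have set: `z^J = z₁^{r₁}⋯z_n^{r_n}`
and likewise for `z^{J′}`." [cite: Bertrand1997DualityTori, §3 (b), proof of the Corollary (pp. 214–215)] -/

variable {g : κ → ℕ} (e : ∀ k, Fin (g k) ⊕ Fin (g k) ≃ σ k) {N : ℕ} (ε : Fin N ≃ Σ k, Fin (g k))
  {d : ∀ k, Fin (g k) → ℕ}

/-- **`E_{λ_z} = Σ_k z_k θ_k`**: the polarisation form of `λ_z = Σ z_k p_k^*λ_k` is the weighted sum of the block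
forms of the product symplectic basis (`θ_k = p_k^*E_k`).
[cite: Bertrand1997DualityTori, §3 (b), proof of the Corollary (p. 214: "`λ_z = z₁p₁^*λ₁ + ⋯ + z_n p_n^*λ_n`")] -/
theorem IsSymplecticEnum.ofRealForm_piForm_smul (h : ∀ k, IsSymplecticEnum (Ψ k) (e k) (ω k) (d k)) :
    ofRealForm (piForm fun k ↦ (z k : ℝ) • ω k) =
      ∑ k, ((z k : ℕ) : ℂ) • blockTwoForm (sigmaPiPeriod Ψ) (sigmaEnum e ε) (sigmaType ε d) (sigmaFactor ε) k := by
  rw [Finset.sum_congr rfl fun k _ ↦ by rw [(h k).blockTwoForm_sigmaPi Ψ ω e ε k]]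
  ext v
  simp [piForm, ofRealForm, ContinuousAlternatingMap.sum_apply]

variable {β : Type*} [Fintype β] [DecidableEq β]

omit [Fintype β] in
/-- `∏_j z_{c j} = ∏_i z_i^{r_i(c)} = z^{J(c)}` ("we have set `z^J = z₁^{r₁}⋯z_n^{r_n}`").
[cite: Bertrand1997DualityTori, §3 (b), proof of the Corollary (p. 215)] -/
theorem prod_apply_word_eq_prod_pow_wordMult [Fintype β] {M : Type*} [CommMonoid M] (zc : β → M) {b : ℕ}
    (c : Fin b → β) : ∏ j, zc (c j) = ∏ i, zc i ^ wordMult c i := by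
  rw [← Finset.prod_fiberwise_of_maps_to' (g := c) (fun j _ ↦ Finset.mem_univ (c j)) zc]
  exact Finset.prod_congr rfl fun i _ ↦ by rw [Finset.prod_const, wordMult_eq]

variable {ι : Type*} [Fintype ι] {E : Type uF} [NormedAddCommGroup E] [NormedSpace ℂ E] (Φ : (ι → ℝ) ≃L[ℝ] E)
  {g₀ : ℕ} (e₀ : Fin g₀ ⊕ Fin g₀ ≃ ι) (d₀ : Fin g₀ → ℕ) (blk : Fin g₀ → β)

omit [Fintype ι] in
/-- **Newton's formula with weights, word form: `(Σ_i z_i θ_i)^{∧b} = Σ_{c : Fin b → β} (∏_j z_{c j}) θ^{c}`**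
(multilinear expansion). [cite: Bertrand1997DualityTori, §3 (b), proof of the Corollary (p. 214: "together with Newton's formula")] -/
theorem wedgePow_sum_smul_blockTwoForm (zc : β → ℂ) (b : ℕ) :
    wedgePow (∑ i, zc i • blockTwoForm Φ e₀ d₀ blk i) b =
      ∑ c : Fin b → β, (∏ j, zc (c j)) • blockPow Φ e₀ d₀ blk c :=
  wedgeFamily_sum_smul b (fun _ ↦ zc) fun _ i ↦ blockTwoForm Φ e₀ d₀ blk i

omit [Fintype ι] in
/-- **Newton's formula with weights, grouped by multidegrees: `(Σ_i z_i θ_i)^{∧b} = Σ_{|J| = b} c(J) z^J · θ^{J}`**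
(`z^J = ∏ z_i^{r_i}`, `c(J) = b!/r₁!⋯r_n!`) — the form-level identity behind
"`deg_{λ_z}(W) = Σ_J c(J) z^J deg_J(W)`". [cite: Bertrand1997DualityTori, §3 (b), proof of the Corollary (pp. 214–215)] -/
theorem wedgePow_sum_smul_blockTwoForm_eq_sum_piAntidiag (zc : β → ℂ) (b : ℕ) (w : (β → ℕ) → (Fin b → β))
    (hw : ∀ J ∈ (univ : Finset β).piAntidiag b, wordMult (w J) = J) :
    wedgePow (∑ i, zc i • blockTwoForm Φ e₀ d₀ blk i) b =
      ∑ J ∈ (univ : Finset β).piAntidiag b,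
        ((Nat.multinomial univ J : ℂ) * ∏ i, zc i ^ J i) • blockPow Φ e₀ d₀ blk (w J) := by
  rw [wedgePow_sum_smul_blockTwoForm,
    ← Finset.sum_fiberwise_of_maps_to (fun c (_ : c ∈ univ) ↦ wordMult_mem_piAntidiag (β := β) c)]
  refine Finset.sum_congr rfl fun J hJ ↦ ?_
  have hcl : ∀ c ∈ univ.filter (fun c : Fin b → β ↦ wordMult c = J),
      (∏ j, zc (c j)) • blockPow Φ e₀ d₀ blk c = (∏ i, zc i ^ J i) • blockPow Φ e₀ d₀ blk c := by
    intro c hc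
    rw [prod_apply_word_eq_prod_pow_wordMult, (Finset.mem_filter.1 hc).2]
  rw [Finset.sum_congr rfl hcl, ← Finset.smul_sum, ← hw J hJ, sum_filter_wordMult_blockPow, hw J hJ, smul_smul,
    mul_comm (∏ i, zc i ^ J i)]

omit [Fintype ι] in
/-- **`deg_{λ_z}(W) = Σ_J c(J) z^J deg_J(W)` on cycles**: `∫_σ (Σ_i z_i θ_i)^{∧b} = Σ_{|J| = b} c(J) z^J ∫_σ θ^{J}`.
[cite: Bertrand1997DualityTori, §3 (b), proof of the Corollary (pp. 214–215)] -/
theorem cycleIntegral_wedgePow_sum_smul_blockTwoForm (zc : β → ℂ) (b : ℕ) (w : (β → ℕ) → (Fin b → β))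
    (hw : ∀ J ∈ (univ : Finset β).piAntidiag b, wordMult (w J) = J) (τ : ⋀[ℤ]^(2 * b) (ι → ℤ)) :
    cycleIntegral Φ (2 * b) τ (wedgePow (∑ i, zc i • blockTwoForm Φ e₀ d₀ blk i) b) =
      ∑ J ∈ (univ : Finset β).piAntidiag b,
        ((Nat.multinomial univ J : ℂ) * ∏ i, zc i ^ J i) * cycleIntegral Φ (2 * b) τ (blockPow Φ e₀ d₀ blk (w J)) := by
  rw [wedgePow_sum_smul_blockTwoForm_eq_sum_piAntidiag Φ e₀ d₀ blk zc b w hw, map_sum]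
  exact Finset.sum_congr rfl fun J _ ↦ by rw [map_smul, smul_eq_mul]

/-- **Bertrand's `deg_{λ_z}(W) = Σ_J c(J) z^J deg_J(W)` for `(A, λ_z) = (∏ C_k, Σ z_k p_k^*λ_k)`, on forms, for every
cycle** (`E_{λ_z}^{∧b} = Σ_J c(J) z^J θ^{J}` integrated over `σ ∈ H_{2b}(A, ℤ)`).
[cite: Bertrand1997DualityTori, §3 (b), proof of the Corollary (pp. 214–215)] -/
theorem IsSymplecticEnum.cycleIntegral_wedgePow_piForm_smul (h : ∀ k, IsSymplecticEnum (Ψ k) (e k) (ω k) (d k)) (b : ℕ) (w : (κ → ℕ) → (Fin b → κ))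
    (hw : ∀ J ∈ (univ : Finset κ).piAntidiag b, wordMult (w J) = J) (τ : ⋀[ℤ]^(2 * b) ((Σ k, σ k) → ℤ)) :
    cycleIntegral (sigmaPiPeriod Ψ) (2 * b) τ (wedgePow (ofRealForm (piForm fun k ↦ (z k : ℝ) • ω k)) b) =
      ∑ J ∈ (univ : Finset κ).piAntidiag b,
        ((Nat.multinomial univ J : ℂ) * ∏ k, ((z k : ℕ) : ℂ) ^ J k) *
          cycleIntegral (sigmaPiPeriod Ψ) (2 * b) τ
            (blockPow (sigmaPiPeriod Ψ) (sigmaEnum e ε) (sigmaType ε d) (sigmaFactor ε) (w J)) := by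
  rw [IsSymplecticEnum.ofRealForm_piForm_smul Ψ ω z e ε h,
    cycleIntegral_wedgePow_sum_smul_blockTwoForm (sigmaPiPeriod Ψ) (sigmaEnum e ε) (sigmaType ε d) (sigmaFactor ε)
      (fun k ↦ ((z k : ℕ) : ℂ)) b w hw τ]

end Weights

/-! ## §8 `B_z`: the `λ_z`-orthogonal complement is `t_z^{-1}(B^⊥)`

"Now, `B^⊥` is the set theoretic image of `B_z` under `t_z`" [cite: Bertrand1997DualityTori, §3 (b), proof of the Corollary (p. 215)]
— at the level of the real span: `V^{⊥_{λ_z}} = diag(z)^{-1} · V^{⊥_λ}`, `diag(z) · V^{⊥_{λ_z}} = V^{⊥_λ}`. -/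

section OrthWeights

variable {κ : Type*} [Fintype κ] [DecidableEq κ] {σ : κ → Type*} [∀ k, Fintype (σ k)] [∀ k, DecidableEq (σ k)]
  {F : κ → Type*} [∀ k, NormedAddCommGroup (F k)] [∀ k, NormedSpace ℂ (F k)]
  (Ψ : ∀ k, (σ k → ℝ) ≃L[ℝ] F k) (ω : ∀ k, F k [⋀^Fin 2]→L[ℝ] ℝ) (z : κ → ℕ)

/-- `(z · 1)_ℝ = z · 1` for the scaled identity block. [folklore] -/
private theorem map_natCast_smul_one {m : Type*} [DecidableEq m] (n : ℕ) :
    ((n : ℤ) • (1 : Matrix m m ℤ)).map (Int.cast : ℤ → ℝ) = (n : ℝ) • (1 : Matrix m m ℝ) := by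
  ext a b
  rw [Matrix.map_apply, Matrix.smul_apply, Matrix.smul_apply, Matrix.one_apply, Matrix.one_apply, smul_eq_mul,
    smul_eq_mul, Int.cast_mul, Int.cast_natCast]
  split_ifs <;> simp

/-- **The rational representation of `t_z` scales the factor `k` by `z_k`: `Π(diag(z) x)_k = z_k · Π(x)_k`.**
[cite: Bertrand1997DualityTori, §3 (b), proof of the Corollary (p. 214: "the 'diagonal' map `t_z = (z₁, …, z_n)` on `C₁ × ⋯ × C_n`")] -/
theorem sigmaPiPeriod_map_sigmaBlockMatrix_smul_one_mulVec (x : (Σ k, σ k) → ℝ) (k : κ) :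
    sigmaPiPeriod Ψ ((sigmaBlockMatrix fun l ↦ (z l : ℤ) • (1 : Matrix (σ l) (σ l) ℤ)).map (Int.cast : ℤ → ℝ) *ᵥ x) k =
      (z k : ℝ) • sigmaPiPeriod Ψ x k := by
  rw [sigmaPiPeriod_apply, sigmaPiPeriod_apply, ← map_smul]
  congr 1
  funext i
  rw [map_sigmaBlockMatrix_mulVec, Pi.smul_apply, smul_eq_mul, map_natCast_smul_one, Matrix.smul_mulVec,
    Matrix.one_mulVec, Pi.smul_apply, smul_eq_mul]

/-- **`λ_z(n, m) = λ(n, diag(z) m)`.** [cite: Bertrand1997DualityTori, §3 (b), proof of the Corollary (p. 214)] -/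
theorem piForm_smul_apply_eq (n m : (Σ k, σ k) → ℝ) :
    piForm (fun k ↦ (z k : ℝ) • ω k) ![sigmaPiPeriod Ψ n, sigmaPiPeriod Ψ m] =
      piForm ω ![sigmaPiPeriod Ψ n, sigmaPiPeriod Ψ
        ((sigmaBlockMatrix fun l ↦ (z l : ℤ) • (1 : Matrix (σ l) (σ l) ℤ)).map (Int.cast : ℤ → ℝ) *ᵥ m)] := by
  rw [piForm_apply, piForm_apply]
  refine Finset.sum_congr rfl fun k _ ↦ ?_
  rw [sigmaPiPeriod_map_sigmaBlockMatrix_smul_one_mulVec, ContinuousAlternatingMap.smul_apply, twoForm_smul_right,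
    smul_eq_mul]

/-- **`B_z = t_z^{-1}(B^⊥)` on the real span: `m ∈ V^{⊥_{λ_z}} ↔ diag(z) m ∈ V^{⊥_λ}`.**
[cite: Bertrand1997DualityTori, §3 (b), proof of the Corollary (p. 215: "`B^⊥` is the set theoretic image of `B_z` under `t_z`")] -/
theorem mem_orthSubspace_piForm_smul_iff (V : Submodule ℝ ((Σ k, σ k) → ℝ)) (m : (Σ k, σ k) → ℝ) :
    m ∈ orthSubspace (sigmaPiPeriod Ψ) (piForm fun k ↦ (z k : ℝ) • ω k) V ↔
      (sigmaBlockMatrix fun l ↦ (z l : ℤ) • (1 : Matrix (σ l) (σ l) ℤ)).map (Int.cast : ℤ → ℝ) *ᵥ m ∈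
        orthSubspace (sigmaPiPeriod Ψ) (piForm ω) V := by
  rw [mem_orthSubspace_iff, mem_orthSubspace_iff]
  refine forall_congr' fun n ↦ forall_congr' fun _ ↦ ?_
  rw [piForm_smul_apply_eq]

/-- The same as an equality of subspaces: `V^{⊥_{λ_z}} = diag(z)^{-1}(V^{⊥_λ})` (`Submodule.comap`).
[cite: Bertrand1997DualityTori, §3 (b), proof of the Corollary (p. 215)] -/
theorem orthSubspace_piForm_smul_eq_comap (V : Submodule ℝ ((Σ k, σ k) → ℝ)) :
    orthSubspace (sigmaPiPeriod Ψ) (piForm fun k ↦ (z k : ℝ) • ω k) V =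
      (orthSubspace (sigmaPiPeriod Ψ) (piForm ω) V).comap
        ((sigmaBlockMatrix fun l ↦ (z l : ℤ) • (1 : Matrix (σ l) (σ l) ℤ)).map (Int.cast : ℤ → ℝ)).mulVecLin := by
  ext m
  rw [Submodule.mem_comap, Matrix.mulVecLin_apply, mem_orthSubspace_piForm_smul_iff]

/-- **"`B^⊥` is the set theoretic image of `B_z` under `t_z`"** on the real span: for `z_k ≠ 0`,
`diag(z) · V^{⊥_{λ_z}} = V^{⊥_λ}`. [cite: Bertrand1997DualityTori, §3 (b), proof of the Corollary (p. 215)] -/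
theorem map_orthSubspace_piForm_smul (hz : ∀ k, z k ≠ 0) (V : Submodule ℝ ((Σ k, σ k) → ℝ)) :
    (orthSubspace (sigmaPiPeriod Ψ) (piForm fun k ↦ (z k : ℝ) • ω k) V).map
        ((sigmaBlockMatrix fun l ↦ (z l : ℤ) • (1 : Matrix (σ l) (σ l) ℤ)).map (Int.cast : ℤ → ℝ)).mulVecLin =
      orthSubspace (sigmaPiPeriod Ψ) (piForm ω) V := by
  rw [orthSubspace_piForm_smul_eq_comap, Submodule.map_comap_eq_of_surjective]
  -- `diag(z)` is invertible over `ℝ`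
  intro y
  refine ⟨fun p ↦ (z p.1 : ℝ)⁻¹ * y p, ?_⟩
  rw [Matrix.mulVecLin_apply]
  funext ⟨k, i⟩
  rw [sigmaBlockMatrix, Matrix.blockDiagonal'_map _ _ Int.cast_zero, blockDiagonal'_mulVec_apply, map_natCast_smul_one,
    Matrix.smul_mulVec, Matrix.one_mulVec, Pi.smul_apply, smul_eq_mul, ← mul_assoc,
    mul_inv_cancel₀ (by exact_mod_cast hz k : (z k : ℝ) ≠ 0), one_mul]

end OrthWeights

end ComplexTorus

end Literature.Geometry.Kaehler

end
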